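import Literature.NumberTheory.LFunctions.RudnickSarnakNExplicit
import Literature.Analysis.SpecialFunctions.DigammaGauss
import Mathlib.Analysis.SpecialFunctions.ImproperIntegrals
import HarnessLib

/-!
# Rudnick–Sarnak `n`-level correlations for `ζ`, III: the archimedean term of one slot

Sibling file of `Literature/NumberTheory/LFunctions/RudnickSarnak.lean` (toward
`Literature.NumberTheory.LFunctions.rudnick_sarnak_unrestricted` at every level); third file of
the general-level machinery (`RudnickSarnakNKernel.lean`, `RudnickSarnakNExplicit.lean`).

Rudnick–Sarnak 1996, Lemma 3.1 (p. 288) controls the archimedean kernel `g_T` of the explicit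
formula: "`g_T(x) ≍ log T` for `|x| ≪ log log T`, `g_T(x) ≪ 1/|x|` beyond, `∫ |g_T| ≪ log T`"
(Stirling's formula for `Γ'/Γ`). In the `t`-windowed form of this programme the corresponding
statement is that the archimedean term `𝒟(a, t)` of one slot (`RudnickSarnakN.archTerm`) is the
zero density times the bump, up to an error decaying in `t`:

  `‖𝒟(a, t) − g₀(a) ℓ(t)‖ ≤ C/(1 + |t|)`,  `ℓ(t) := log |1/4 + it/2| − log π = log(t/2π) + O(t⁻²)`

(`RudnickSarnakN.norm_archTerm_sub_le`), uniformly in the frequency `a`. Ingredients: Fourier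
inversion `(1/2π) ∫ e^{ias} κ(s) ds = g₀(a)` (`weilMellin_inversion`), the vertical series for
`Re ψ(1/4 + it/2)` (`Literature.Analysis.SpecialFunctions.hasSum_digammaTerm`), which gives the
Lipschitz-with-decay estimate `|Re ψ(1/4+i(s+t)/2) − Re ψ(1/4+it/2)| ≤ 1100 (|s|+|s|³)/(1+|t|)`
(`RudnickSarnakN.abs_reDigammaQuarter_add_sub_le`), Stirling in the form
`Literature.Analysis.SpecialFunctions.Complex.abs_re_digamma_sub_log_norm_le`, and the decay
`κ(r) ≤ C/(1+r²)³` of the kernel. Also recorded: the conjugate zeros are negligible,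
`‖S⁻(a, t)‖ ≤ C/(1 + t²)` for `t ≥ 0` (`RudnickSarnakN.norm_zeroSumMinus_le_of_nonneg`), and
`‖S⁺(a, t)‖ ≤ C log(|t| + 2)`.

## References

* Z. Rudnick, P. Sarnak, *Zeros of principal `L`-functions and random matrix theory*, Duke Math.
  J. 81 (1996), 269–322, Lemma 3.1 and (3.16)–(3.18).
-/

noncomputable section

open Complex Filter Set MeasureTheory
open scoped Real Topology ComplexConjugate

namespace Literature.NumberTheory.LFunctions

namespace RudnickSarnakN

open Literature.Analysis.SpecialFunctions
open Montgomery (exists_density_le)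

/-! ## Sixth-order decay of the kernel -/

/-- `κ(r) ≤ C/(1 + r²)³` (four integrations by parts: `(g₀⁗)^(s) = (s − 1/2)⁴ ĝ₀(s)`).
[folklore] -/
theorem exists_ker_le_cube : ∃ C : ℝ, 0 < C ∧ ∀ r : ℝ, ker r ≤ C / (1 + r ^ 2) ^ 3 := by
  obtain ⟨C₂, hC₂, h₂⟩ := exists_ker_le
  set g4 := deriv (deriv (deriv (deriv g0)))
  have hg4 : IsWeilTest g4 := g0_isWeilTest.deriv.deriv.deriv.deriv
  set C₄ := weilDecayConst g4
  have hC₄ : 0 ≤ C₄ := weilDecayConst_nonneg _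
  refine ⟨2 * C₂ + 2 * C₄ + 1, by linarith, fun r ↦ ?_⟩
  have hs0 : (0 : ℝ) ≤ (1 / 2 + r * I : ℂ).re := by simp
  have hs1 : (1 / 2 + r * I : ℂ).re ≤ 1 := by norm_num [Complex.add_re]
  have him : (1 / 2 + r * I : ℂ).im = r := by simp
  have h4 : ‖weilMellin g4 (1 / 2 + r * I)‖ ≤ C₄ / (1 + r ^ 2) := by
    have := norm_weilMellin_le hg4 hs0 hs1; rwa [him] at this
  have e4 : weilMellin g4 (1 / 2 + r * I) =
      ((1 / 2 + r * I : ℂ) - 1 / 2) ^ 2 * (((1 / 2 + r * I : ℂ) - 1 / 2) ^ 2 * weilMellin g0 (1 / 2 + r * I)) := by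
    simp only [g4]
    rw [weilMellin_deriv_deriv g0_isWeilTest.deriv.deriv, weilMellin_deriv_deriv g0_isWeilTest]
  rw [e4, ← mul_assoc, ← pow_add, norm_mul, weilMellin_g0_half] at h4
  have e : ‖((1 / 2 + r * I : ℂ) - 1 / 2) ^ (2 + 2)‖ = r ^ 4 := by
    rw [show (1 / 2 + r * I : ℂ) - 1 / 2 = r * I by ring, norm_pow, norm_mul, Complex.norm_I,
      mul_one, Complex.norm_real, Real.norm_eq_abs, show (2 + 2 : ℕ) = 2 * 2 from rfl, pow_mul, sq_abs]
    ring
  rw [e, Complex.norm_real, Real.norm_of_nonneg (ker_nonneg r)] at h4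
  have hk := ker_nonneg r
  have hpos : 0 < 1 + r ^ 2 := by positivity
  have h2r := h₂ r
  rw [le_div_iff₀ (by positivity)] at h2r
  rw [le_div_iff₀ hpos] at h4
  rw [le_div_iff₀ (by positivity)]
  nlinarith [sq_nonneg r, sq_nonneg (r ^ 2), mul_nonneg hk (sq_nonneg r)]

/-! ## The digamma weight `λ(t) = Re ψ(1/4 + it/2)`: Lipschitz estimate with decay -/

/-- The telescoping majorant: for `l ≥ 3/2` and every `b`,
`2l/(l² + b²)² ≤ 1/((l−1)² + b²) − 1/((l+1)² + b²)`. [folklore] -/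
theorem two_mul_div_sq_le_sub {l : ℝ} (hl : 3 / 2 ≤ l) (b : ℝ) :
    2 * l / (l ^ 2 + b ^ 2) ^ 2 ≤ 1 / ((l - 1) ^ 2 + b ^ 2) - 1 / ((l + 1) ^ 2 + b ^ 2) := by
  have hA : 0 < (l - 1) ^ 2 + b ^ 2 := by nlinarith [sq_nonneg b]
  have hB : 0 < (l + 1) ^ 2 + b ^ 2 := by nlinarith [sq_nonneg b]
  have hX : 0 < l ^ 2 + b ^ 2 := by nlinarith [sq_nonneg b]
  rw [div_sub_div _ _ hA.ne' hB.ne', div_le_div_iff₀ (by positivity) (by positivity)]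
  have key : ((l - 1) ^ 2 + b ^ 2) * ((l + 1) ^ 2 + b ^ 2) ≤ 2 * (l ^ 2 + b ^ 2) ^ 2 := by
    nlinarith [sq_nonneg (l ^ 2 + b ^ 2 - 1), sq_nonneg b, sq_nonneg l]
  have e : 1 * ((l + 1) ^ 2 + b ^ 2) - ((l - 1) ^ 2 + b ^ 2) * 1 = 4 * l := by ring
  rw [e]
  nlinarith [key, hX]

/-- The vertical kernel sum: for all `u, v` and `M`,
`Σ_{m<M} 2 l_m/((l_m² + u²)(l_m² + v²)) ≤ 17/(1 + min(u², v²))` (`l_m = 2m + 1/2`; the `m = 0`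
term is `≤ 16/(1+b²)` and the rest telescopes to `≤ 1/(9/4 + b²)`). [folklore] -/
theorem sum_digammaKernel_le (u v : ℝ) (M : ℕ) :
    ∑ m ∈ Finset.range M, 2 * digammaNode m / ((digammaNode m ^ 2 + u ^ 2) * (digammaNode m ^ 2 + v ^ 2)) ≤
      17 / (1 + min (u ^ 2) (v ^ 2)) := by
  set b2 : ℝ := min (u ^ 2) (v ^ 2) with hb2
  have hb2_nonneg : 0 ≤ b2 := le_min (sq_nonneg u) (sq_nonneg v)
  have hb2u : b2 ≤ u ^ 2 := min_le_left _ _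
  have hb2v : b2 ≤ v ^ 2 := min_le_right _ _
  obtain ⟨b, hb0, hbsq⟩ : ∃ b : ℝ, 0 ≤ b ∧ b ^ 2 = b2 := ⟨Real.sqrt b2, Real.sqrt_nonneg _, Real.sq_sqrt hb2_nonneg⟩
  -- termwise: replace `u, v` by `b`
  have hterm : ∀ m : ℕ, 2 * digammaNode m / ((digammaNode m ^ 2 + u ^ 2) * (digammaNode m ^ 2 + v ^ 2)) ≤
      2 * digammaNode m / (digammaNode m ^ 2 + b ^ 2) ^ 2 := by
    intro m
    have hl := digammaNode_pos m
    refine div_le_div_of_nonneg_left (by linarith) (by positivity) ?_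
    rw [sq (digammaNode m ^ 2 + b ^ 2)]
    exact mul_le_mul (by linarith) (by linarith) (by positivity) (by positivity)
  refine (Finset.sum_le_sum fun m _ ↦ hterm m).trans ?_
  -- the telescoping sequence
  set A : ℕ → ℝ := fun m ↦ 1 / ((2 * (m : ℝ) - 1 / 2) ^ 2 + b ^ 2) with hA
  have hstep : ∀ m : ℕ, 1 ≤ m → 2 * digammaNode m / (digammaNode m ^ 2 + b ^ 2) ^ 2 ≤ A m - A (m + 1) := by
    intro m hm
    have hm' : (1 : ℝ) ≤ m := by exact_mod_cast hm
    have hl : (3 / 2 : ℝ) ≤ digammaNode m := by unfold digammaNode; linarith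
    have h := two_mul_div_sq_le_sub hl b
    have e1 : digammaNode m - 1 = 2 * (m : ℝ) - 1 / 2 := by unfold digammaNode; ring
    have e2 : digammaNode m + 1 = 2 * ((m + 1 : ℕ) : ℝ) - 1 / 2 := by unfold digammaNode; push_cast; ring
    rw [e1, e2] at h
    exact h
  cases M with
  | zero => simp; positivity
  | succ M =>
    rw [Finset.sum_range_succ']
    -- the `m = 0` term
    have h0 : 2 * digammaNode 0 / (digammaNode 0 ^ 2 + b ^ 2) ^ 2 ≤ 16 / (1 + b2) := by
      unfold digammaNode
      simp only [Nat.cast_zero, mul_zero, zero_add]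
      rw [div_le_div_iff₀ (by positivity) (by positivity), hbsq.symm]
      nlinarith [sq_nonneg b, sq_nonneg (b ^ 2)]
    -- the tail telescopes
    have htail : ∑ m ∈ Finset.range M, 2 * digammaNode (m + 1) / (digammaNode (m + 1) ^ 2 + b ^ 2) ^ 2 ≤
        A 1 := by
      calc ∑ m ∈ Finset.range M, 2 * digammaNode (m + 1) / (digammaNode (m + 1) ^ 2 + b ^ 2) ^ 2
          ≤ ∑ m ∈ Finset.range M, (A (m + 1) - A (m + 1 + 1)) :=
            Finset.sum_le_sum fun m _ ↦ hstep (m + 1) (by omega)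
        _ = A 1 - A (M + 1) := Finset.sum_range_sub' (fun i ↦ A (i + 1)) M
        _ ≤ A 1 := by
            have : 0 ≤ A (M + 1) := by simp only [hA]; positivity
            linarith
    have hA1 : A 1 ≤ 1 / (1 + b2) := by
      simp only [hA, Nat.cast_one]
      rw [← hbsq]
      exact one_div_le_one_div_of_le (by positivity) (by nlinarith)
    have h16 : 16 / (1 + b2) + 1 / (1 + b2) = 17 / (1 + b2) := by rw [← add_div]; norm_num
    linarith

/-- The vertical kernel is summable (its terms are `≤ 2/l_m³ ≤ 16/(m+1)²`). [folklore] -/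
theorem summable_digammaKernel (u v : ℝ) :
    Summable fun m : ℕ ↦ 2 * digammaNode m / ((digammaNode m ^ 2 + u ^ 2) * (digammaNode m ^ 2 + v ^ 2)) := by
  have hmaj : Summable fun m : ℕ ↦ (16 : ℝ) * (1 / ((m : ℝ) + 1) ^ 2) :=
    hasSum_one_div_nat_add_one_sq.summable.mul_left 16
  refine Summable.of_nonneg_of_le (fun m ↦ ?_) (fun m ↦ ?_) hmaj
  · have := digammaNode_pos m; positivity
  have hl := digammaNode_pos m
  calc 2 * digammaNode m / ((digammaNode m ^ 2 + u ^ 2) * (digammaNode m ^ 2 + v ^ 2))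
      ≤ 2 * digammaNode m / (digammaNode m ^ 2 * digammaNode m ^ 2) := by
        refine div_le_div_of_nonneg_left (by linarith) (by positivity) ?_
        exact mul_le_mul (by nlinarith) (by nlinarith) (by positivity) (by positivity)
    _ = 2 / digammaNode m ^ 3 := by field_simp
    _ ≤ 16 * (1 / ((m : ℝ) + 1) ^ 2) := two_div_digammaNode_cube_le m

/-- **Lipschitz estimate for `Re ψ(1/4 + it/2)` in the variable `t²`**:
`|λ(u) − λ(v)| ≤ 17 |u² − v²| / (1 + min(u², v²))` (termwise from the vertical series,
`digammaTerm_sub`). [folklore] -/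
theorem abs_reDigammaQuarter_sub_le' (u v : ℝ) :
    |reDigammaQuarter u - reDigammaQuarter v| ≤ 17 * |u ^ 2 - v ^ 2| / (1 + min (u ^ 2) (v ^ 2)) := by
  have h := (hasSum_digammaTerm u).sub (hasSum_digammaTerm v)
  have e : reDigammaQuarter u - reDigammaQuarter 0 - (reDigammaQuarter v - reDigammaQuarter 0) =
      reDigammaQuarter u - reDigammaQuarter v := by ring
  rw [e] at h
  set K : ℕ → ℝ := fun m ↦ 2 * digammaNode m / ((digammaNode m ^ 2 + u ^ 2) * (digammaNode m ^ 2 + v ^ 2))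
  have hterm : ∀ m : ℕ, digammaTerm (digammaNode m) u - digammaTerm (digammaNode m) v = (u ^ 2 - v ^ 2) * K m := by
    intro m
    rw [digammaTerm_sub (digammaNode_pos m)]
    simp only [K]
    ring
  have hK : Summable K := summable_digammaKernel u v
  have hKnn : ∀ m, 0 ≤ K m := fun m ↦ by have := digammaNode_pos m; positivity
  rw [← h.tsum_eq]
  simp_rw [hterm]
  rw [tsum_mul_left, abs_mul,
    show (17 : ℝ) * |u ^ 2 - v ^ 2| / (1 + min (u ^ 2) (v ^ 2)) = |u ^ 2 - v ^ 2| * (17 / (1 + min (u ^ 2) (v ^ 2))) by ring]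
  refine mul_le_mul_of_nonneg_left ?_ (abs_nonneg _)
  rw [abs_of_nonneg (tsum_nonneg hKnn)]
  exact Real.tsum_le_of_sum_range_le hKnn (sum_digammaKernel_le u v)

/-- **Lipschitz with decay**: `|λ(s + t) − λ(t)| ≤ 1100 (|s| + |s|³)/(1 + |t|)` for all real
`s, t` (`λ(t) = Re ψ(1/4 + it/2)`; for `2|s| ≤ |t|` from the previous estimate, otherwise from the
quadratic growth `λ(t) − ψ(1/4) ≤ 27 t²`). [folklore] -/
theorem abs_reDigammaQuarter_add_sub_le (s t : ℝ) :
    |reDigammaQuarter (s + t) - reDigammaQuarter t| ≤ 1100 * (|s| + |s| ^ 3) / (1 + |t|) := by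
  have hs0 := abs_nonneg s
  have ht0 := abs_nonneg t
  have hs3 : s ^ 2 ≤ |s| + |s| ^ 3 := by
    have := sq_abs s
    nlinarith [mul_nonneg hs0 (sq_nonneg (|s| - 1))]
  rw [le_div_iff₀ (by positivity)]
  by_cases hcase : 2 * |s| ≤ |t|
  · -- near range: the Lipschitz estimate
    have h := abs_reDigammaQuarter_sub_le' (s + t) t
    have hmin : t ^ 2 / 4 ≤ min ((s + t) ^ 2) (t ^ 2) := by
      refine le_min ?_ (by nlinarith [sq_nonneg t])
      have h1 : |t| - |s| ≤ |s + t| := by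
        have := abs_sub_abs_le_abs_sub t (-s)
        rw [abs_neg, sub_neg_eq_add, add_comm] at this
        exact this
      have h2 : |t| / 2 ≤ |t| - |s| := by linarith
      have h3 : (|t| / 2) ^ 2 ≤ |s + t| ^ 2 := pow_le_pow_left₀ (by positivity) (h2.trans h1) 2
      rw [sq_abs, div_pow, sq_abs] at h3
      linarith
    have hnum : |(s + t) ^ 2 - t ^ 2| ≤ |s| * (|s| + 2 * |t|) := by
      rw [show (s + t) ^ 2 - t ^ 2 = s * (s + 2 * t) by ring, abs_mul]
      refine mul_le_mul_of_nonneg_left ((abs_add_le _ _).trans ?_) hs0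
      rw [abs_mul, abs_two]
    have step : |reDigammaQuarter (s + t) - reDigammaQuarter t| ≤ 17 * (|s| * (|s| + 2 * |t|)) / (1 + t ^ 2 / 4) := by
      refine h.trans ?_
      rw [div_le_div_iff₀ (by positivity) (by positivity)]
      have := mul_le_mul hnum (by linarith [hmin] : 1 + t ^ 2 / 4 ≤ 1 + min ((s + t) ^ 2) (t ^ 2))
        (by positivity) (by positivity)
      nlinarith [abs_nonneg ((s + t) ^ 2 - t ^ 2)]
    -- `17 |s|(|s| + 2|t|)(1+|t|) ≤ 1100 (|s| + |s|³)(1 + t²/4)`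
    have key : 17 * (|s| * (|s| + 2 * |t|)) * (1 + |t|) ≤ 1100 * (|s| + |s| ^ 3) * (1 + t ^ 2 / 4) := by
      have ht2 : |t| ^ 2 = t ^ 2 := sq_abs t
      nlinarith [mul_nonneg hs0 ht0, mul_nonneg (mul_nonneg hs0 ht0) ht0, mul_nonneg hs0 (sq_nonneg (|t| - 2)),
        mul_nonneg (mul_nonneg hs0 hs0) ht0, pow_nonneg hs0 3, mul_nonneg (pow_nonneg hs0 3) (sq_nonneg t)]
    calc |reDigammaQuarter (s + t) - reDigammaQuarter t| * (1 + |t|)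
        ≤ 17 * (|s| * (|s| + 2 * |t|)) / (1 + t ^ 2 / 4) * (1 + |t|) :=
          mul_le_mul_of_nonneg_right step (by positivity)
      _ ≤ 1100 * (|s| + |s| ^ 3) := by
          rw [div_mul_eq_mul_div, div_le_iff₀ (by positivity)]
          exact key
  · -- far range: quadratic growth
    push Not at hcase
    have h1 := reDigammaQuarter_sub_le (s + t)
    have h2 := reDigammaQuarter_sub_le t
    have h1' := reDigammaQuarter_zero_le (s + t)
    have h2' := reDigammaQuarter_zero_le t
    have hd : |reDigammaQuarter (s + t) - reDigammaQuarter t| ≤ 27 * (s + t) ^ 2 + 27 * t ^ 2 := by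
      rw [abs_le]; constructor <;> nlinarith
    have hst : (s + t) ^ 2 ≤ 9 * s ^ 2 := by
      have : |s + t| ≤ 3 * |s| := (abs_add_le _ _).trans (by linarith)
      have := pow_le_pow_left₀ (abs_nonneg _) this 2
      rw [sq_abs, mul_pow, sq_abs] at this
      linarith
    have htt : t ^ 2 ≤ 4 * s ^ 2 := by
      have := pow_le_pow_left₀ ht0 hcase.le 2
      rw [sq_abs, mul_pow, sq_abs] at this
      linarith
    have ht1 : 1 + |t| ≤ 1 + 2 * |s| := by linarith
    calc |reDigammaQuarter (s + t) - reDigammaQuarter t| * (1 + |t|)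
        ≤ (351 * s ^ 2) * (1 + 2 * |s|) := mul_le_mul (by nlinarith) ht1 (by positivity) (by positivity)
      _ ≤ 1100 * (|s| + |s| ^ 3) := by
          have : s ^ 2 = |s| ^ 2 := (sq_abs s).symm
          rw [this]
          nlinarith [pow_nonneg hs0 3, mul_nonneg hs0 (sq_nonneg (|s| - 1))]

/-! ## The smooth density `ℓ(t) = log |1/4 + it/2| − log π` -/

/-- The smooth comparison weight `ℓ(t) := log ‖1/4 + it/2‖ − log π` (`= log(t/2π) + O(t⁻²)`):
by Stirling, `Re ψ(1/4 + it/2) − log π = ℓ(t) + O(1/|t|)`, and `(1/2π)(Re ψ(1/4+it/2) − log π)`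
is the density of the zeros at height `t` (Rudnick–Sarnak 1996, (2.11)/(3.18)). [cite: RudnickSarnak1996, (3.18)] -/
def ell (t : ℝ) : ℝ :=
  Real.log ‖(1 / 4 : ℂ) + t / 2 * I‖ - Real.log π

/-- `‖1/4 + it/2‖² = 1/16 + t²/4`. [folklore] -/
theorem norm_quarter_add_sq (t : ℝ) : ‖(1 / 4 : ℂ) + t / 2 * I‖ ^ 2 = 1 / 16 + t ^ 2 / 4 := by
  rw [Complex.sq_norm, Complex.normSq_apply]
  simp
  ring

/-- `|t|/2 ≤ ‖1/4 + it/2‖ ≤ 1/4 + |t|/2`, and `1/4 ≤ ‖1/4 + it/2‖`. [folklore] -/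
theorem norm_quarter_add_mem (t : ℝ) :
    max (1 / 4) (|t| / 2) ≤ ‖(1 / 4 : ℂ) + t / 2 * I‖ ∧ ‖(1 / 4 : ℂ) + t / 2 * I‖ ≤ 1 / 4 + |t| / 2 := by
  have h := norm_quarter_add_sq t
  have hn := norm_nonneg ((1 / 4 : ℂ) + t / 2 * I)
  have ht := abs_nonneg t
  have ht2 : |t| ^ 2 = t ^ 2 := sq_abs t
  refine ⟨max_le ?_ ?_, ?_⟩
  · nlinarith
  · nlinarith
  · nlinarith

/-- `|ℓ(t)| ≤ log(|t| + 2) + 3`. [folklore] -/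
theorem abs_ell_le (t : ℝ) : |ell t| ≤ Real.log (|t| + 2) + 3 := by
  obtain ⟨h1, h2⟩ := norm_quarter_add_mem t
  have hq : (1 / 4 : ℝ) ≤ ‖(1 / 4 : ℂ) + t / 2 * I‖ := (le_max_left _ _).trans h1
  have hpos : 0 < ‖(1 / 4 : ℂ) + t / 2 * I‖ := by linarith
  have hup : Real.log ‖(1 / 4 : ℂ) + t / 2 * I‖ ≤ Real.log (|t| + 2) :=
    Real.log_le_log hpos (by linarith [abs_nonneg t])
  have hlow : Real.log (1 / 4) ≤ Real.log ‖(1 / 4 : ℂ) + t / 2 * I‖ := Real.log_le_log (by norm_num) hq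
  have hl4 : Real.log (1 / 4) = -(2 * Real.log 2) := by
    rw [show (1 / 4 : ℝ) = (2 ^ 2)⁻¹ by norm_num, Real.log_inv, Real.log_pow]; ring
  have hlog2 := Real.log_two_lt_d9
  have hpi : Real.log π ≤ 1.1447299 := Real.log_pi_le
  have hpi0 : 0 ≤ Real.log π := Real.log_nonneg (by linarith [Real.pi_gt_three])
  have hlog0 : 0 ≤ Real.log (|t| + 2) := Real.log_nonneg (by linarith [abs_nonneg t])
  unfold ell
  rw [abs_le]
  constructor <;> linarith

/-- `ℓ` is continuous. [folklore] -/
theorem continuous_ell : Continuous ell := by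
  unfold ell
  refine Continuous.sub (Continuous.log (by fun_prop) fun t ↦ ?_) continuous_const
  have := (norm_quarter_add_mem t).1
  have : (1 / 4 : ℝ) ≤ ‖(1 / 4 : ℂ) + t / 2 * I‖ := (le_max_left _ _).trans this
  linarith

/-- `ℓ(t) − log(|t|/(2π)) ∈ [0, 1/(8t²)]` for `t ≠ 0` (`log ‖w‖ − log(|t|/2) = ½ log(1 + 1/(4t²))`).
[folklore] -/
theorem ell_sub_log_mem {t : ℝ} (ht : t ≠ 0) :
    0 ≤ ell t - Real.log (|t| / (2 * π)) ∧ ell t - Real.log (|t| / (2 * π)) ≤ 1 / (8 * t ^ 2) := by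
  have htpos : 0 < |t| := abs_pos.2 ht
  obtain ⟨h1, -⟩ := norm_quarter_add_mem t
  have hw : |t| / 2 ≤ ‖(1 / 4 : ℂ) + t / 2 * I‖ := (le_max_right _ _).trans h1
  have hwpos : 0 < ‖(1 / 4 : ℂ) + t / 2 * I‖ := by linarith
  have e : ell t - Real.log (|t| / (2 * π)) = Real.log ‖(1 / 4 : ℂ) + t / 2 * I‖ - Real.log (|t| / 2) := by
    unfold ell
    rw [Real.log_div htpos.ne' (by positivity), Real.log_div htpos.ne' (by norm_num),
      Real.log_mul (by norm_num) Real.pi_pos.ne']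
    ring
  rw [e]
  constructor
  · linarith [Real.log_le_log (by positivity) hw]
  · -- `log ‖w‖ - log(|t|/2) ≤ ‖w‖/(|t|/2) - 1 = (‖w‖ - |t|/2)(2/|t|) ≤ 1/(8 t²)`
    set N : ℝ := ‖(1 / 4 : ℂ) + t / 2 * I‖ with hN
    have hsq := norm_quarter_add_sq t
    rw [← hN] at hsq
    have ht2 : |t| ^ 2 = t ^ 2 := sq_abs t
    have hprod : (N - |t| / 2) * (N + |t| / 2) = 1 / 16 := by nlinarith
    have hd : N - |t| / 2 ≤ 1 / (16 * |t|) := by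
      rw [le_div_iff₀ (by positivity)]
      nlinarith
    have hlog : Real.log N - Real.log (|t| / 2) ≤ N / (|t| / 2) - 1 := by
      rw [← Real.log_div hwpos.ne' (by positivity)]
      exact Real.log_le_sub_one_of_pos (by positivity)
    have h3 : N / (|t| / 2) - 1 = (N - |t| / 2) * (2 / |t|) := by
      field_simp
    rw [h3] at hlog
    calc Real.log N - Real.log (|t| / 2) ≤ (N - |t| / 2) * (2 / |t|) := hlog
      _ ≤ 1 / (16 * |t|) * (2 / |t|) := mul_le_mul_of_nonneg_right hd (by positivity)
      _ = 1 / (8 * t ^ 2) := by rw [← ht2]; field_simp; ring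

/-- **Stirling on the line `Re s = 1/4`**: `|Re ψ(1/4 + it/2) − log π − ℓ(t)| ≤ C/(1 + |t|)` with
`C = 3 |ψ(1/4)| + 340` (for `|t| ≥ 2` from `abs_re_digamma_sub_log_norm_le`, for `|t| ≤ 2` from the
quadratic growth bound). [folklore] -/
theorem abs_reDigammaQuarter_sub_ell_le (t : ℝ) :
    |reDigammaQuarter t - Real.log π - ell t| ≤ (3 * |reDigammaQuarter 0| + 340) / (1 + |t|) := by
  have ht := abs_nonneg t
  have e : reDigammaQuarter t - Real.log π - ell t = reDigammaQuarter t - Real.log ‖(1 / 4 : ℂ) + t / 2 * I‖ := by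
    unfold ell; ring
  rw [e, le_div_iff₀ (by positivity)]
  obtain ⟨h1, h2⟩ := norm_quarter_add_mem t
  have hq : (1 / 4 : ℝ) ≤ ‖(1 / 4 : ℂ) + t / 2 * I‖ := (le_max_left _ _).trans h1
  by_cases hcase : 2 ≤ |t|
  · -- Stirling
    set w : ℂ := (1 / 4 : ℂ) + t / 2 * I with hw
    have hwre : 0 < w.re := by simp [hw]
    have hwim : w.im = t / 2 := by simp [hw]
    have htne : t ≠ 0 := by intro h; rw [h, abs_zero] at hcase; norm_num at hcase
    have hwim0 : w.im ≠ 0 := by rw [hwim]; exact div_ne_zero htne two_ne_zero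
    have hS := Literature.Analysis.SpecialFunctions.Complex.abs_re_digamma_sub_log_norm_le hwre hwim0
    have hlam : reDigammaQuarter t = (Complex.digamma w).re := rfl
    rw [← hlam, hwim] at hS
    have hwn : |t| / 2 ≤ ‖w‖ := (le_max_right _ _).trans h1
    have hwn1 : 1 ≤ ‖w‖ := by linarith
    have hb1 : 1 / (2 * ‖w‖ ^ 2) ≤ 2 / t ^ 2 := by
      rw [div_le_div_iff₀ (by positivity) (by positivity)]
      have : t ^ 2 / 4 ≤ ‖w‖ ^ 2 := by
        have := pow_le_pow_left₀ (by positivity) hwn 2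
        rw [div_pow, sq_abs] at this; linarith
      nlinarith
    have hb2 : π / (4 * |t / 2|) = π / (2 * |t|) := by
      rw [abs_div, abs_two]; ring
    rw [hb2] at hS
    have htpos : 0 < |t| := by linarith
    have ht2 : |t| ^ 2 = t ^ 2 := sq_abs t
    -- `(2/t² + π/(2|t|)) (1 + |t|) ≤ 340` for `|t| ≥ 2`
    have hpi := Real.pi_lt_four
    calc |reDigammaQuarter t - Real.log ‖w‖| * (1 + |t|)
        ≤ (2 / t ^ 2 + π / (2 * |t|)) * (1 + |t|) := by
          refine mul_le_mul_of_nonneg_right (hS.trans (by linarith)) (by positivity)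
      _ ≤ 3 * |reDigammaQuarter 0| + 340 := by
          rw [← ht2]
          have e1 : (2 / |t| ^ 2 + π / (2 * |t|)) * (1 + |t|) = (2 + 2 * |t| + π / 2 * |t| + π / 2 * |t| ^ 2) / |t| ^ 2 := by
            field_simp
            ring
          rw [e1, div_le_iff₀ (by positivity)]
          nlinarith [abs_nonneg (reDigammaQuarter 0), mul_nonneg htpos.le (by linarith : (0:ℝ) ≤ |t| - 2)]
  · push Not at hcase
    have hg := abs_reDigammaQuarter_le t
    have hlog : |Real.log ‖(1 / 4 : ℂ) + t / 2 * I‖| ≤ 2 := by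
      have hup : Real.log ‖(1 / 4 : ℂ) + t / 2 * I‖ ≤ Real.log 2 :=
        Real.log_le_log (by linarith) (by linarith)
      have hlow : Real.log (1 / 4) ≤ Real.log ‖(1 / 4 : ℂ) + t / 2 * I‖ := Real.log_le_log (by norm_num) hq
      have hl4 : Real.log (1 / 4) = -(2 * Real.log 2) := by
        rw [show (1 / 4 : ℝ) = (2 ^ 2)⁻¹ by norm_num, Real.log_inv, Real.log_pow]; ring
      have hlog2 := Real.log_two_lt_d9
      rw [abs_le]; constructor <;> linarith
    have htri : |reDigammaQuarter t - Real.log ‖(1 / 4 : ℂ) + t / 2 * I‖| ≤ |reDigammaQuarter 0| + 27 * t ^ 2 + 2 := by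
      have := abs_sub (reDigammaQuarter t) (Real.log ‖(1 / 4 : ℂ) + t / 2 * I‖)
      linarith
    have ht4 : t ^ 2 ≤ 4 := by
      have := pow_le_pow_left₀ ht hcase.le 2
      rw [sq_abs] at this; linarith
    calc |reDigammaQuarter t - Real.log ‖(1 / 4 : ℂ) + t / 2 * I‖| * (1 + |t|)
        ≤ (|reDigammaQuarter 0| + 27 * 4 + 2) * (1 + 2) :=
          mul_le_mul (by linarith) (by linarith) (by positivity) (by positivity)
      _ ≤ 3 * |reDigammaQuarter 0| + 340 := by nlinarith [abs_nonneg (reDigammaQuarter 0)]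

/-! ## The archimedean term of one slot is `g₀(a) ℓ(t) + O(1/(1+|t|))` -/

/-- Fourier inversion for the kernel: `∫ e^{ias} κ(s) ds = 2π g₀(a)` (`weilMellin_inversion` on
the critical line; `g₀` is even). [folklore] -/
theorem integral_cexp_mul_ker (a : ℝ) :
    ∫ s : ℝ, cexp (((a * s : ℝ) : ℂ) * I) * (ker s : ℂ) = 2 * π * g0 a := by
  have h := weilMellin_inversion g0_isWeilTest (1 / 2) (-a)
  have e : ∀ y : ℝ, weilMellin g0 (((1 / 2 : ℝ) : ℂ) + y * I) * cexp (-(y * I) * ((-a : ℝ) : ℂ)) =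
      cexp (((a * y : ℝ) : ℂ) * I) * (ker y : ℂ) := by
    intro y
    rw [show (((1 / 2 : ℝ) : ℂ) + y * I) = 1 / 2 + y * I by push_cast; ring, weilMellin_g0_half, mul_comm]
    congr 2
    push_cast; ring
  simp_rw [e] at h
  rw [h, g0_neg]
  have : (((1 / 2 : ℝ) : ℂ) - 1 / 2) * ((-a : ℝ) : ℂ) = 0 := by push_cast; ring
  rw [this, Complex.exp_zero, mul_one]

/-- The archimedean integrand is integrable (`κ ≤ C/(1+s²)³`, `|λ| ≤ |ψ(1/4)| + 27(s+t)²`).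
[folklore] -/
theorem integrable_archIntegrand (a t : ℝ) :
    Integrable fun s : ℝ ↦ cexp (((a * s : ℝ) : ℂ) * I) * (ker s : ℂ) * (reDigammaQuarter (s + t) : ℂ) := by
  obtain ⟨C, hC0, hC⟩ := exists_ker_le_cube
  set K : ℝ := C * (|reDigammaQuarter 0| + 54 + 54 * t ^ 2)
  refine Integrable.mono' (integrable_inv_one_add_sq.const_mul K) ?_ (Eventually.of_forall fun s ↦ ?_)
  · refine Continuous.aestronglyMeasurable ?_
    refine Continuous.mul (Continuous.mul (by fun_prop) (Complex.continuous_ofReal.comp continuous_ker)) ?_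
    exact Complex.continuous_ofReal.comp (continuous_reDigammaQuarter.comp (continuous_id.add continuous_const))
  · rw [norm_mul, norm_mul, Complex.norm_exp_ofReal_mul_I, one_mul, Complex.norm_real, Complex.norm_real,
      Real.norm_of_nonneg (ker_nonneg s), Real.norm_eq_abs]
    have hlam := abs_reDigammaQuarter_le (s + t)
    have hk := hC s
    have hks := ker_nonneg s
    have hpos : 0 < 1 + s ^ 2 := by positivity
    -- `ker s * |λ(s+t)| ≤ C (|λ0| + 27 (s+t)²)/(1+s²)³ ≤ K/(1+s²)`
    have h1 : ker s * |reDigammaQuarter (s + t)| ≤ C / (1 + s ^ 2) ^ 3 * (|reDigammaQuarter 0| + 27 * (s + t) ^ 2) :=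
      mul_le_mul hk hlam (abs_nonneg _) (by positivity)
    refine h1.trans ?_
    rw [div_mul_eq_mul_div, div_le_iff₀ (by positivity)]
    have hst : (s + t) ^ 2 ≤ 2 * s ^ 2 + 2 * t ^ 2 := by nlinarith [sq_nonneg (s - t)]
    have h3 : (1 + s ^ 2) ^ 3 = (1 + s ^ 2) * (1 + s ^ 2) ^ 2 := by ring
    have h4 : 1 ≤ (1 + s ^ 2) ^ 2 := one_le_pow₀ (by nlinarith [sq_nonneg s])
    have h5 : 2 * s ^ 2 ≤ 2 * (1 + s ^ 2) ^ 2 := by nlinarith [sq_nonneg s, sq_nonneg (s ^ 2)]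
    calc C * (|reDigammaQuarter 0| + 27 * (s + t) ^ 2)
        ≤ C * (|reDigammaQuarter 0| + 54 * s ^ 2 + 54 * t ^ 2) := by
          refine mul_le_mul_of_nonneg_left ?_ hC0.le; nlinarith
      _ ≤ K * (1 + s ^ 2)⁻¹ * (1 + s ^ 2) ^ 3 := by
          rw [h3, ← mul_assoc, mul_assoc K, inv_mul_cancel₀ hpos.ne', mul_one]
          simp only [K]
          have hl0 := abs_nonneg (reDigammaQuarter 0)
          nlinarith [mul_nonneg hC0.le hl0, mul_nonneg hC0.le (sq_nonneg t), mul_nonneg (mul_nonneg hC0.le hl0) (by linarith : (0:ℝ) ≤ (1 + s ^ 2) ^ 2 - 1),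
            mul_nonneg (mul_nonneg hC0.le (sq_nonneg t)) (by linarith : (0:ℝ) ≤ (1 + s ^ 2) ^ 2 - 1)]

/-- The archimedean term minus its main part is an explicit integral:
`𝒟(a,t) − g₀(a)(λ(t) − log π) = (1/2π) ∫ e^{ias} κ(s) (λ(s+t) − λ(t)) ds`. [folklore] -/
theorem archTerm_sub_eq (a t : ℝ) :
    archTerm a t - g0 a * ((reDigammaQuarter t : ℂ) - Real.log π) =
      (1 / (2 * π) : ℂ) * ∫ s : ℝ, cexp (((a * s : ℝ) : ℂ) * I) * (ker s : ℂ) *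
        ((reDigammaQuarter (s + t) : ℂ) - reDigammaQuarter t) := by
  have hI := integrable_archIntegrand a t
  have hJ : Integrable fun s : ℝ ↦ cexp (((a * s : ℝ) : ℂ) * I) * (ker s : ℂ) * (reDigammaQuarter t : ℂ) := by
    have h0 := integrable_archIntegrand a 0
    have h0' : Integrable fun s : ℝ ↦ cexp (((a * s : ℝ) : ℂ) * I) * (ker s : ℂ) := by
      have hc : Continuous fun s : ℝ ↦ cexp (((a * s : ℝ) : ℂ) * I) * (ker s : ℂ) :=
        Continuous.mul (by fun_prop) (Complex.continuous_ofReal.comp continuous_ker)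
      obtain ⟨C, hC0, hC⟩ := exists_ker_le_cube
      refine Integrable.mono' (integrable_inv_one_add_sq.const_mul C) hc.aestronglyMeasurable
        (Eventually.of_forall fun s ↦ ?_)
      rw [norm_mul, Complex.norm_exp_ofReal_mul_I, one_mul, Complex.norm_real, Real.norm_of_nonneg (ker_nonneg s)]
      refine (hC s).trans ?_
      rw [div_eq_mul_inv]
      refine mul_le_mul_of_nonneg_left ?_ hC0.le
      refine inv_anti₀ (by positivity) ?_
      have : 1 ≤ 1 + s ^ 2 := by nlinarith [sq_nonneg s]
      calc (1 + s ^ 2) = (1 + s ^ 2) * 1 * 1 := by ring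
        _ ≤ (1 + s ^ 2) * (1 + s ^ 2) * (1 + s ^ 2) := by gcongr
        _ = (1 + s ^ 2) ^ 3 := by ring
    exact h0'.mul_const _
  have hsplit : (∫ s : ℝ, cexp (((a * s : ℝ) : ℂ) * I) * (ker s : ℂ) *
      ((reDigammaQuarter (s + t) : ℂ) - reDigammaQuarter t)) =
      (∫ s : ℝ, cexp (((a * s : ℝ) : ℂ) * I) * (ker s : ℂ) * (reDigammaQuarter (s + t) : ℂ)) -
        (∫ s : ℝ, cexp (((a * s : ℝ) : ℂ) * I) * (ker s : ℂ)) * reDigammaQuarter t := by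
    rw [← integral_mul_const, ← integral_sub hI hJ]
    congr 1 with s; ring
  rw [hsplit, archTerm, integral_cexp_mul_ker]
  set J : ℂ := ∫ s : ℝ, cexp (((a * s : ℝ) : ℂ) * I) * (ker s : ℂ) * (reDigammaQuarter (s + t) : ℂ)
  have hπ : (π : ℂ) ≠ 0 := by exact_mod_cast Real.pi_pos.ne'
  field_simp
  ring

/-- The constant of the archimedean error bound. [folklore] -/
def archErrConst : ℝ :=
  1100 * Classical.choose exists_ker_le_cube + bumpMass * (3 * |reDigammaQuarter 0| + 340)

/-- `archErrConst ≥ 0`. [folklore] -/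
theorem archErrConst_nonneg : 0 ≤ archErrConst := by
  have h := (Classical.choose_spec exists_ker_le_cube).1
  unfold archErrConst
  have := bumpMass_pos
  positivity

/-- **The archimedean term of one slot** (Rudnick–Sarnak 1996, Lemma 3.1 / (3.18), in windowed
form): `‖𝒟(a, t) − g₀(a) ℓ(t)‖ ≤ C/(1 + |t|)` for all real `a, t`, with `C = archErrConst`
independent of `a` and `t`. [cite: RudnickSarnak1996, Lemma 3.1] -/
theorem norm_archTerm_sub_le (a t : ℝ) :
    ‖archTerm a t - g0 a * (ell t : ℂ)‖ ≤ archErrConst / (1 + |t|) := by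
  set C₃ := Classical.choose exists_ker_le_cube with hC₃def
  obtain ⟨hC₃0, hC₃⟩ := Classical.choose_spec exists_ker_le_cube
  have ht := abs_nonneg t
  -- Step 1: the oscillatory integral
  have h1 : ‖archTerm a t - g0 a * ((reDigammaQuarter t : ℂ) - Real.log π)‖ ≤ 1100 * C₃ / (1 + |t|) := by
    rw [archTerm_sub_eq, norm_mul]
    have hn : ‖(1 / (2 * π) : ℂ)‖ = 1 / (2 * π) := by
      rw [show (1 / (2 * π) : ℂ) = ((1 / (2 * π) : ℝ) : ℂ) by push_cast; ring, Complex.norm_real,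
        Real.norm_of_nonneg (by positivity)]
    rw [hn]
    -- pointwise majorant `1100 C₃/(1+|t|) · (1+s²)⁻¹`
    have hmaj : ∀ s : ℝ, ‖cexp (((a * s : ℝ) : ℂ) * I) * (ker s : ℂ) *
        ((reDigammaQuarter (s + t) : ℂ) - reDigammaQuarter t)‖ ≤ 1100 * C₃ / (1 + |t|) * (1 + s ^ 2)⁻¹ := by
      intro s
      rw [norm_mul, norm_mul, Complex.norm_exp_ofReal_mul_I, one_mul, Complex.norm_real,
        Real.norm_of_nonneg (ker_nonneg s), ← Complex.ofReal_sub, Complex.norm_real, Real.norm_eq_abs]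
      have hL := abs_reDigammaQuarter_add_sub_le s t
      have hk := hC₃ s
      have hs := abs_nonneg s
      calc ker s * |reDigammaQuarter (s + t) - reDigammaQuarter t|
          ≤ C₃ / (1 + s ^ 2) ^ 3 * (1100 * (|s| + |s| ^ 3) / (1 + |t|)) :=
            mul_le_mul hk hL (abs_nonneg _) (by positivity)
        _ = 1100 * C₃ / (1 + |t|) * ((|s| + |s| ^ 3) / (1 + s ^ 2) ^ 3) := by ring
        _ ≤ 1100 * C₃ / (1 + |t|) * (1 + s ^ 2)⁻¹ := by
            refine mul_le_mul_of_nonneg_left ?_ (by positivity)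
            rw [div_le_iff₀ (by positivity), ← sq_abs s]
            have h3 : (1 + |s| ^ 2)⁻¹ * (1 + |s| ^ 2) ^ 3 = (1 + |s| ^ 2) ^ 2 := by
              have : (1 + |s| ^ 2) ≠ 0 := by positivity
              field_simp
            rw [h3]
            nlinarith [mul_nonneg hs (sq_nonneg (|s| - 1)), sq_nonneg (|s| ^ 2), pow_nonneg hs 3, mul_nonneg (pow_nonneg hs 3) (sq_nonneg (|s| - 1))]
    have hint : Integrable fun s : ℝ ↦ 1100 * C₃ / (1 + |t|) * (1 + s ^ 2)⁻¹ :=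
      integrable_inv_one_add_sq.const_mul _
    calc 1 / (2 * π) * ‖∫ s : ℝ, cexp (((a * s : ℝ) : ℂ) * I) * (ker s : ℂ) *
          ((reDigammaQuarter (s + t) : ℂ) - reDigammaQuarter t)‖
        ≤ 1 / (2 * π) * ∫ s : ℝ, 1100 * C₃ / (1 + |t|) * (1 + s ^ 2)⁻¹ :=
          mul_le_mul_of_nonneg_left (norm_integral_le_of_norm_le hint (Eventually.of_forall hmaj)) (by positivity)
      _ = 1 / (2 * π) * (1100 * C₃ / (1 + |t|) * π) := by rw [integral_const_mul, integral_univ_inv_one_add_sq]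
      _ = 1100 * C₃ / (1 + |t|) * (1 / 2) := by field_simp
      _ ≤ 1100 * C₃ / (1 + |t|) := by
          have : 0 ≤ 1100 * C₃ / (1 + |t|) := by positivity
          linarith
  -- Step 2: Stirling
  have h2 : ‖g0 a * ((reDigammaQuarter t : ℂ) - Real.log π) - g0 a * (ell t : ℂ)‖ ≤
      bumpMass * (3 * |reDigammaQuarter 0| + 340) / (1 + |t|) := by
    rw [← mul_sub, norm_mul, ← Complex.ofReal_sub, ← Complex.ofReal_sub, Complex.norm_real, Real.norm_eq_abs,
      mul_div_assoc]
    exact mul_le_mul (norm_g0_le a) (abs_reDigammaQuarter_sub_ell_le t) (abs_nonneg _) bumpMass_pos.le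
  calc ‖archTerm a t - g0 a * (ell t : ℂ)‖
      = ‖(archTerm a t - g0 a * ((reDigammaQuarter t : ℂ) - Real.log π)) +
          (g0 a * ((reDigammaQuarter t : ℂ) - Real.log π) - g0 a * (ell t : ℂ))‖ := by congr 1; ring
    _ ≤ 1100 * C₃ / (1 + |t|) + bumpMass * (3 * |reDigammaQuarter 0| + 340) / (1 + |t|) :=
        (norm_add_le _ _).trans (add_le_add h1 h2)
    _ = archErrConst / (1 + |t|) := by rw [archErrConst, ← hC₃def, add_div]

/-- Corollary: `‖𝒟(a, t)‖ ≤ ∫φ · (log(|t|+2) + 3) + archErrConst`. [folklore] -/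
theorem norm_archTerm_le (a t : ℝ) :
    ‖archTerm a t‖ ≤ bumpMass * (Real.log (|t| + 2) + 3) + archErrConst := by
  have h1 := norm_archTerm_sub_le a t
  have h2 : ‖g0 a * (ell t : ℂ)‖ ≤ bumpMass * (Real.log (|t| + 2) + 3) := by
    rw [norm_mul, Complex.norm_real, Real.norm_eq_abs]
    exact mul_le_mul (norm_g0_le a) (abs_ell_le t) (abs_nonneg _) bumpMass_pos.le
  have h3 : archErrConst / (1 + |t|) ≤ archErrConst :=
    div_le_self archErrConst_nonneg (by linarith [abs_nonneg t])
  calc ‖archTerm a t‖ = ‖(archTerm a t - g0 a * (ell t : ℂ)) + g0 a * (ell t : ℂ)‖ := by congr 1; ring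
    _ ≤ ‖archTerm a t - g0 a * (ell t : ℂ)‖ + ‖g0 a * (ell t : ℂ)‖ := norm_add_le _ _
    _ ≤ _ := by linarith

/-! ## The conjugate zeros and the size of the windowed zero sum -/

/-- **The conjugate zeros are negligible**: there is `C` with `‖S⁻(a, t)‖ ≤ C/(1 + t²)` for all
`a` and all `t ≥ 0` (`κ(t + γ) ≤ C_κ/((1+t²)(1+γ²))` for `t, γ ≥ 0`, and `Σ_n 1/(1+γ_n²) < ∞`).
[folklore] -/
theorem exists_norm_zeroSumMinus_le :
    ∃ C : ℝ, 0 ≤ C ∧ ∀ a t : ℝ, 0 ≤ t → ‖zeroSumMinus a t‖ ≤ C / (1 + t ^ 2) := by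
  obtain ⟨Cκ, hCκ, hκ⟩ := exists_ker_le
  set S : ℝ := ∑' n : ℕ, 1 / (1 + zetaOrdinate n ^ 2)
  have hS := Montgomery.summable_one_div_one_add_zetaOrdinate_sq
  have hS0 : 0 ≤ S := tsum_nonneg fun n ↦ by positivity
  refine ⟨Cκ * S, by positivity, fun a t ht ↦ ?_⟩
  refine (norm_zeroSumMinus_le a t).trans ?_
  have hterm : ∀ n : ℕ, ker (t + zetaOrdinate n) ≤ Cκ / (1 + t ^ 2) * (1 / (1 + zetaOrdinate n ^ 2)) := by
    intro n
    have hγ := (zetaOrdinate_pos_holds n).le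
    refine (hκ _).trans ?_
    rw [mul_one_div, div_div, div_le_div_iff_of_pos_left hCκ (by positivity) (by positivity)]
    have : 1 + t ^ 2 ≤ 1 + (t + zetaOrdinate n) ^ 2 := by nlinarith [mul_nonneg ht hγ]
    have : 1 + zetaOrdinate n ^ 2 ≤ 1 + (t + zetaOrdinate n) ^ 2 := by nlinarith [mul_nonneg ht hγ]
    calc (1 + t ^ 2) * (1 + zetaOrdinate n ^ 2) ≤ (1 + (t + zetaOrdinate n) ^ 2) * (1 + (t + zetaOrdinate n) ^ 2) := by
          gcongr
      _ = (1 + (t + zetaOrdinate n) ^ 2) ^ 2 := by ring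
  calc ∑' n : ℕ, ker (t + zetaOrdinate n) ≤ ∑' n : ℕ, Cκ / (1 + t ^ 2) * (1 / (1 + zetaOrdinate n ^ 2)) :=
        (summable_ker_add t).tsum_le_tsum hterm (hS.mul_left _)
    _ = Cκ * S / (1 + t ^ 2) := by rw [tsum_mul_left]; ring

/-- **Size of the windowed zero sum**: there is `C` with `‖S⁺(a, t)‖ ≤ C log(|t| + 2)` for all
`a, t` (`Σ_n κ(t − γ_n) ≤ C_κ Σ_n 1/(1+(t−γ_n)²) ≤ C_κ A log(|t|+2)`, `exists_density_le`;
Rudnick–Sarnak 1996, (2.16): `N(T+1) − N(T) ≪ log T`). [cite: RudnickSarnak1996, (2.16)] -/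
theorem exists_norm_zeroSumPlus_le :
    ∃ C : ℝ, 0 ≤ C ∧ ∀ a t : ℝ, ‖zeroSumPlus a t‖ ≤ C * Real.log (|t| + 2) := by
  obtain ⟨Cκ, hCκ, hκ⟩ := exists_ker_le
  obtain ⟨A, hA0, hA⟩ := exists_density_le
  refine ⟨Cκ * A, by positivity, fun a t ↦ (norm_zeroSumPlus_le a t).trans ?_⟩
  have hterm : ∀ n : ℕ, ker (t - zetaOrdinate n) ≤ Cκ * (1 / (1 + (t - zetaOrdinate n) ^ 2)) := by
    intro n
    refine (hκ _).trans ?_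
    rw [mul_one_div, div_le_div_iff_of_pos_left hCκ (by positivity) (by positivity)]
    nlinarith [sq_nonneg (t - zetaOrdinate n)]
  calc ∑' n : ℕ, ker (t - zetaOrdinate n) ≤ ∑' n : ℕ, Cκ * (1 / (1 + (t - zetaOrdinate n) ^ 2)) :=
        (summable_ker_sub t).tsum_le_tsum hterm ((hA t).1.mul_left _)
    _ = Cκ * ∑' n : ℕ, 1 / (1 + (t - zetaOrdinate n) ^ 2) := tsum_mul_left
    _ ≤ Cκ * (A * Real.log (|t| + 2)) := mul_le_mul_of_nonneg_left (hA t).2 hCκ.le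
    _ = Cκ * A * Real.log (|t| + 2) := by ring

/-- The sum `Σ_n κ(t − γ_n)` is bounded by `C log(|t| + 2)` (real form of the previous bound). [folklore] -/
theorem exists_tsum_ker_sub_le :
    ∃ C : ℝ, 0 ≤ C ∧ ∀ t : ℝ, ∑' n : ℕ, ker (t - zetaOrdinate n) ≤ C * Real.log (|t| + 2) := by
  obtain ⟨Cκ, hCκ, hκ⟩ := exists_ker_le
  obtain ⟨A, hA0, hA⟩ := exists_density_le
  refine ⟨Cκ * A, by positivity, fun t ↦ ?_⟩
  have hterm : ∀ n : ℕ, ker (t - zetaOrdinate n) ≤ Cκ * (1 / (1 + (t - zetaOrdinate n) ^ 2)) := by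
    intro n
    refine (hκ _).trans ?_
    rw [mul_one_div, div_le_div_iff_of_pos_left hCκ (by positivity) (by positivity)]
    nlinarith [sq_nonneg (t - zetaOrdinate n)]
  calc ∑' n : ℕ, ker (t - zetaOrdinate n) ≤ ∑' n : ℕ, Cκ * (1 / (1 + (t - zetaOrdinate n) ^ 2)) :=
        (summable_ker_sub t).tsum_le_tsum hterm ((hA t).1.mul_left _)
    _ = Cκ * ∑' n : ℕ, 1 / (1 + (t - zetaOrdinate n) ^ 2) := tsum_mul_left
    _ ≤ Cκ * (A * Real.log (|t| + 2)) := mul_le_mul_of_nonneg_left (hA t).2 hCκ.le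
    _ = Cκ * A * Real.log (|t| + 2) := by ring

end RudnickSarnakN

end Literature.NumberTheory.LFunctions

end
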